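import Literature.Computability.QuantumComplexity.PauliMomentStabilizerClass
import Literature.Computability.QuantumComplexity.PauliReduce

/-!
# The `(W, k)`-Pauli moment table of a pure state: cut purity, stabilizer cut law, product law, separation

Sequel of `PauliMomentStabilizerClass.lean` (namespace `Literature.Computability.QuantumComplexity.PauliMoments`).
For a pure state `ψ` on `n` qubits, a wire set `W ⊆ Fin n` and `k : ℕ`,
`cutMoment W k ψ = 2^{-|W|} Σ_{S supported in W} |a_S(ψ)|^{2k}`:
* (T5a) BRIDGE (Observation 3 + block Parseval of `PauliReduce`): the row `W = univ` is the Pauli moment `W_k(ψ)`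
  (`cutMoment_univ`); the column `k = 1` is the CUT PURITY `Tr ρ_W(ψ)²`, `ρ_W = reduceTo W |ψ⟩⟨ψ|` (`cutMoment_one`);
* (T5b) STABILIZER CUT LAW [FattalEtAl2004, Proof 1]: exactly the frame words fix a unit framed state
  (`StabFrame.word_of_mulVec_smul`, [AaronsonGottesman2004, Thm 1 (iii)]); such a state has
  `cutMoment W k s = #{T : w(T) supported in W} / 2^{|W|}` for every `k ≥ 1`, so `W_k(s) = 1`, while the cut purity
  is what the frame allows: `|Φ⁺⟩` has cut purity `1/2` (`cutMoment_bell`);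
* (T5c) PRODUCT LAW (folklore): `cutMoment W k (⊗ vᵢ) = Π_{i ∈ W} qubitMoment k vᵢ`; the witness `u = (2|0⟩+|1⟩)/√5`
  has `qubitMoment 1 u = 1`, `qubitMoment 2 u = 481/625`, so `u^{⊗n}` has every cut purity `1` yet `W₂ = (481/625)ⁿ`;
* (T5d) SEPARATION: on `u^{⊗n}` every stabilizer-frame superposition `φ = Σ cᵢ tᵢ` obeys
  `|⟨φ|u^{⊗n}⟩|⁸ ≤ ‖c‖₁⁸ (481/625)ⁿ` ((T0) of `PauliMomentStabilizerBounds` at `k = 2`, [BravyiEtAl2019, §2]);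
  on `|Φ⁺⟩` (framed, `W₂ = 1`) every product state has fidelity `≤ 1/2`. The bond-dimension input (column `k = 1`)
  and the stabilizer-extent input (row `W = univ`) are independent coordinates of one table.

## References

* [FattalEtAl2004] D. Fattal, T. S. Cubitt, Y. Yamamoto, S. Bravyi, I. L. Chuang, arXiv:quant-ph/0406168, Proof 1
  (`ρ = 2⁻ⁿ Σ_{g∈S} g`, `ρ_B = 2^{-n_B} Σ_{g∈S_B} g`; e-print, equations unnumbered) and Result 1.
* [AaronsonGottesman2004] S. Aaronson, D. Gottesman, Phys. Rev. A 70 (2004) 052328, Thm 1 (iii)–(iv).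
* [KempeEtAl2010] J. Kempe, O. Regev, F. Unger, R. de Wolf, Quantum Inf. Comput. 10 (2010) 361, Obs. 3, Lemma 7.
* [LeoneOlivieroHamma2021] L. Leone, S. F. E. Oliviero, A. Hamma, Phys. Rev. Lett. 128 (2022) 050402, property (i).
* [BravyiEtAl2019] S. Bravyi et al., Quantum 3 (2019) 181; arXiv:1808.00128, §2.
-/

noncomputable section

open Matrix Finset Literature.Computability.QuantumComplexity

namespace Literature.Computability.QuantumComplexity.PauliMoments

variable {n : ℕ} {s : Reg n → ℂ}

/-! ### (1) The table and the bridge -/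

/-- The `(W, k)`-PAULI MOMENT of `ψ`: `2^{-|W|} Σ_{S ∈ stringsOn W} |a_S(ψ)|^{2k}` (strings equal to `I`
outside `W`). [folklore] -/
def cutMoment (W : Finset (Fin n)) (k : ℕ) (ψ : Reg n → ℂ) : ℝ :=
  (∑ S ∈ stringsOn W, ‖pauliExp ψ S‖ ^ (2 * k)) / 2 ^ W.card

/-- The CUT PURITY `Tr ρ_W(ψ)² = Σ_{x,y} |ρ_W(ψ)_{xy}|²`, `ρ_W(ψ) = reduceTo W |ψ⟩⟨ψ|` the tree's embedded
partial trace (Hermitian, so the Hilbert–Schmidt norm square is `Tr ρ_W²`). [cite: KempeEtAl2010, §3] -/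
def cutPurity (W : Finset (Fin n)) (ψ : Reg n → ℂ) : ℝ := ∑ x, ∑ y, ‖reduceTo W (proj ψ) x y‖ ^ 2

/-- Row `W = univ` of the table is the Pauli moment `W_k`.
[cite: LeoneOlivieroHamma2021, eq. (1)–(2) (`Ξ_P(ψ) = d⁻¹⟨ψ|P|ψ⟩²`, `M_α`)] -/
theorem cutMoment_univ (k : ℕ) (ψ : Reg n → ℂ) : cutMoment Finset.univ k ψ = moment k ψ := by
  rw [cutMoment, moment, stringsOn_univ, Finset.card_univ, Fintype.card_fin]

/-- BRIDGE: column `k = 1` of the table is the cut purity, `Tr ρ_W(ψ)² = 2^{-|W|} Σ_{S ⊆ W} |a_S(ψ)|²`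
(the tree's Observation 3 + block Parseval). [cite: KempeEtAl2010, Observation 3 and Lemma 7] -/
theorem cutMoment_one (W : Finset (Fin n)) (ψ : Reg n → ℂ) : cutMoment W 1 ψ = cutPurity W ψ := by
  have h := pauliWeight_eq_card_pow_mul_norm_reduceTo (proj ψ) W
  rw [pauliWeight_eq] at h
  have h2 : (0 : ℝ) < 2 ^ W.card := by positivity
  rw [cutMoment, cutPurity, div_eq_iff h2.ne']
  simpa [pauliExp, mul_comm] using h

/-- Monotonicity in the cut: `W ⊆ W'` ⇒ `2^{|W|}·cutMoment W k ≤ 2^{|W'|}·cutMoment W' k`.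
[cite: KempeEtAl2010, §3] -/
theorem cutMoment_mono {W W' : Finset (Fin n)} (h : W ⊆ W') (k : ℕ) (ψ : Reg n → ℂ) :
    2 ^ W.card * cutMoment W k ψ ≤ 2 ^ W'.card * cutMoment W' k ψ := by
  have h2 : ∀ V : Finset (Fin n), (2 : ℝ) ^ V.card * cutMoment V k ψ =
      ∑ S ∈ stringsOn V, ‖pauliExp ψ S‖ ^ (2 * k) := fun V => by
    rw [cutMoment, mul_div_cancel₀ _ (by positivity)]
  rw [h2, h2]
  exact Finset.sum_le_sum_of_subset_of_nonneg (stringsOn_mono h) fun _ _ _ => by positivity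

/-! ### (2) The stabilizer cut law -/

/-- Sum form: for a unit framed state every `|a_S(s)|` is `0` or `1`, so the `(W, k)` block sum COUNTS the
frame words supported in `W`.
[cite: FattalEtAl2004, Proof 1 (`ρ = 2⁻ⁿ Σ_{g∈S} g`, `ρ_B = 2^{-n_B} Σ_{g∈S_B} g`)] -/
theorem StabFrame.sum_stringsOn_eq_card (F : StabFrame s) (hs : normSq s = 1) (W : Finset (Fin n))
    (k : ℕ) (hk : 1 ≤ k) :
    ∑ S ∈ stringsOn W, ‖pauliExp s S‖ ^ (2 * k) =
      ((Finset.univ.filter fun T => F.word T ∈ stringsOn W).card : ℝ) := by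
  classical
  have hg : ∀ S, ‖pauliExp s S‖ ^ (2 * k) = if ∃ T, F.word T = S then (1 : ℝ) else 0 := by
    intro S
    split_ifs with h
    · obtain ⟨T, rfl⟩ := h
      rw [F.pauliExp_word, F.norm_sign_eq_one hs, one_pow]
    · push Not at h
      rw [F.pauliExp_eq_zero (fun T hT => h T hT.symm), norm_zero, zero_pow (by omega)]
  rw [Finset.sum_congr rfl (fun S _ => hg S), Finset.sum_boole]
  have himg : (stringsOn W).filter (fun S => ∃ T, F.word T = S) =
      (Finset.univ.filter fun T => F.word T ∈ stringsOn W).image F.word := by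
    ext S
    simp only [Finset.mem_filter, Finset.mem_image, Finset.mem_univ, true_and]
    constructor
    · rintro ⟨hS, T, rfl⟩; exact ⟨T, hS, rfl⟩
    · rintro ⟨T, hT, rfl⟩; exact ⟨hT, T, rfl⟩
  rw [himg, Finset.card_image_of_injective _ F.word_injective]

/-- STABILIZER CUT LAW: `cutMoment W k s = #{T : w(T) supported in W} / 2^{|W|}` for unit framed `s` and
every `k ≥ 1`; at `k = 1` this is the stabilizer entanglement formula `Tr ρ_W² = |G_W| / 2^{|W|}`.
[cite: FattalEtAl2004, Proof 1 (`ρ = 2⁻ⁿ Σ_{g∈S} g`, `ρ_B = 2^{-n_B} Σ_{g∈S_B} g`)] -/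
theorem StabFrame.cutMoment_eq (F : StabFrame s) (hs : normSq s = 1) (W : Finset (Fin n)) (k : ℕ)
    (hk : 1 ≤ k) :
    cutMoment W k s = ((Finset.univ.filter fun T => F.word T ∈ stringsOn W).card : ℝ) / 2 ^ W.card := by
  rw [cutMoment, F.sum_stringsOn_eq_card hs W k hk]

/-- Unit framed states SATURATE the moments: `W_k(s) = 1` for every `k ≥ 1` ((T1) is tight at `ψ = s`).
[cite: LeoneOlivieroHamma2021, property (i) (faithfulness: `M_α(ψ) = 0` iff `ψ` is a stabilizer state)] -/
theorem StabFrame.moment_eq_one (F : StabFrame s) (hs : normSq s = 1) (k : ℕ) (hk : 1 ≤ k) :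
    moment k s = 1 := by
  rw [← cutMoment_univ, F.cutMoment_eq hs _ k hk]
  have : (Finset.univ.filter fun T : Reg n => F.word T ∈ stringsOn (Finset.univ : Finset (Fin n))) =
      Finset.univ := by
    simp [stringsOn_univ]
  rw [this, Finset.card_univ, card_reg, Finset.card_univ, Fintype.card_fin]
  push_cast
  exact div_self (by positivity)

/-- EXACTLY the frame words (AG04 Thm 1 (iii)–(iv) «stabilized by exactly 2ⁿ Pauli operators»):
for a unit framed `s`, every Pauli eigen-relation `σ_S s = c·s` has `S = w(T)` and `c = ε_T` for some label
`T` — no signed Pauli word outside the frame fixes `s`. [cite: AaronsonGottesman2004, Thm 1] -/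
theorem StabFrame.word_of_mulVec_smul (F : StabFrame s) (hs : normSq s = 1) {S : PWord n} {c : ℂ}
    (h : pauliString S *ᵥ s = c • s) : ∃ T, S = F.word T ∧ c = F.sign T := by
  have ha : pauliExp s S = c := by
    rw [pauliExp_eq_dotProduct, h, dotProduct_smul, ← normSq_coe, hs]; simp
  have hc : c ≠ 0 := by
    rintro rfl
    have h0 : normSq (pauliString S *ᵥ s) = 0 := by rw [h, zero_smul]; simp [normSq]
    rw [normSq_mulVec, hs] at h0
    exact one_ne_zero h0
  by_cases hT : ∃ T, S = F.word T
  · obtain ⟨T, rfl⟩ := hT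
    exact ⟨T, rfl, by rw [← ha, F.pauliExp_word]⟩
  · push Not at hT
    exact absurd (ha.symm.trans (F.pauliExp_eq_zero hT)) hc

/-- Bell: only the identity word of `bellFrame` is supported on qubit `0`, so the cut purity of `|Φ⁺⟩`
across `{0} | {1}` is `1/2` (flat Schmidt spectrum of rank 2).
[cite: FattalEtAl2004, Result 1 (`E(ψ) = ½|S_AB|`; EPR example `S = ⟨XX, ZZ⟩`, `E = 1`)] -/
theorem cutMoment_bell : cutMoment ({0} : Finset (Fin 2)) 1 bellKet = 1 / 2 := by
  rw [bellFrame.cutMoment_eq normSq_bellKet _ 1 le_rfl, Finset.card_singleton, pow_one]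
  have : (Finset.univ.filter fun T : Reg 2 => bellFrame.word T ∈ stringsOn ({0} : Finset (Fin 2))) =
      {fun _ => false} := by
    ext T
    simp only [Finset.mem_filter, Finset.mem_univ, true_and, Finset.mem_singleton, mem_stringsOn,
      Finset.mem_singleton]
    constructor
    · intro h
      have h1 := h 1 (by decide)
      simp only [bellFrame, bellPauli] at h1
      funext i
      fin_cases i
      · by_contra hc
        simp at hc
        simp [hc] at h1
        split_ifs at h1
      · by_contra hc
        simp at hc
        simp [hc] at h1
        split_ifs at h1
    · rintro rfl i hi
      simp [bellFrame, bellPauli]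
  rw [this, Finset.card_singleton]
  norm_num

/-! ### (3) Product states: the table factorises -/

/-- `|v⟩⟨v|` of one qubit. [folklore] -/
def qubitProj (v : Bool → ℂ) : Matrix Bool Bool ℂ := Matrix.of fun p q => v p * star (v q)

/-- Single-qubit Pauli expectation `Tr(σ_P |v⟩⟨v|)`. [folklore] -/
def qubitExp (v : Bool → ℂ) (P : Pauli) : ℂ := (P.mat * qubitProj v).trace

/-- Single-qubit `k`-moment `(Σ_P |a_P(v)|^{2k}) / 2`. [folklore] -/
def qubitMoment (k : ℕ) (v : Bool → ℂ) : ℝ := (∑ P : Pauli, ‖qubitExp v P‖ ^ (2 * k)) / 2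

/-- The product state `⊗ᵢ vᵢ`: amplitude `Πᵢ vᵢ(xᵢ)` (bond dimension `1` across every cut). [folklore] -/
def productKet (v : Fin n → Bool → ℂ) : Reg n → ℂ := fun x => ∏ i, v i (x i)

/-- `|⊗vᵢ⟩⟨⊗vᵢ| = ⊗ |vᵢ⟩⟨vᵢ|` as a `tensorAll`. [cite: NielsenChuang2010, §2.1.7] -/
theorem proj_productKet (v : Fin n → Bool → ℂ) :
    proj (productKet v) = tensorAll fun i => qubitProj (v i) := by
  ext x y
  simp only [proj, productKet, Matrix.of_apply, tensorAll_apply, qubitProj, star_prod,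
    ← Finset.prod_mul_distrib]

/-- Pauli expectations of a product state factorise: `a_S(⊗vᵢ) = Πᵢ a_{Sᵢ}(vᵢ)`.
[cite: LeoneOlivieroHamma2021, property (iii) (additivity `M_α(ψ ⊗ φ) = M_α(ψ) + M_α(φ)`)] -/
theorem pauliExp_productKet (v : Fin n → Bool → ℂ) (S : PWord n) :
    pauliExp (productKet v) S = ∏ i, qubitExp (v i) (S i) := by
  rw [pauliExp, pauliCoeff_eq, proj_productKet, pauliString_eq, tensorAll_mul, trace_tensorAll]
  rfl

/-- The `(W, k)` block sum of a product state as a product over the wires.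
[cite: LeoneOlivieroHamma2021, property (iii) (additivity)] -/
theorem sum_stringsOn_productKet (W : Finset (Fin n)) (k : ℕ) (v : Fin n → Bool → ℂ) :
    ∑ S ∈ stringsOn W, ‖pauliExp (productKet v) S‖ ^ (2 * k) =
      ∏ i, (if i ∈ W then ∑ P : Pauli, ‖qubitExp (v i) P‖ ^ (2 * k)
        else ‖qubitExp (v i) Pauli.I‖ ^ (2 * k)) := by
  have : ∀ i, (if i ∈ W then ∑ P : Pauli, ‖qubitExp (v i) P‖ ^ (2 * k)
        else ‖qubitExp (v i) Pauli.I‖ ^ (2 * k)) =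
      ∑ P ∈ (if i ∈ W then Finset.univ else {Pauli.I}), ‖qubitExp (v i) P‖ ^ (2 * k) := by
    intro i; split_ifs <;> simp
  simp only [this]
  rw [Finset.prod_univ_sum, stringsOn]
  refine Finset.sum_congr rfl fun S _ => ?_
  rw [pauliExp_productKet, norm_prod, ← Finset.prod_pow]

/-- `a_I(v) = ‖v‖²`. [cite: NielsenChuang2010, §2.1.4] -/
theorem qubitExp_I (v : Bool → ℂ) : qubitExp v Pauli.I = ((‖v false‖ ^ 2 + ‖v true‖ ^ 2 : ℝ) : ℂ) := by
  simp [qubitExp, qubitProj, Pauli.mat, Matrix.trace, Complex.mul_conj', add_comm]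

/-- PRODUCT LAW: for unit factors the table factorises, `cutMoment W k (⊗vᵢ) = Π_{i ∈ W} qubitMoment k vᵢ`.
[cite: LeoneOlivieroHamma2021, property (iii) (additivity)] -/
theorem cutMoment_productKet (W : Finset (Fin n)) (k : ℕ) (v : Fin n → Bool → ℂ)
    (hv : ∀ i, ‖v i false‖ ^ 2 + ‖v i true‖ ^ 2 = 1) :
    cutMoment W k (productKet v) = ∏ i ∈ W, qubitMoment k (v i) := by
  rw [cutMoment, sum_stringsOn_productKet]
  have h1 : ∀ i, ‖qubitExp (v i) Pauli.I‖ ^ (2 * k) = 1 := fun i => by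
    rw [qubitExp_I, hv i]; simp
  simp only [h1, Finset.prod_ite_mem, Finset.univ_inter, qubitMoment]
  rw [Finset.prod_div_distrib, Finset.prod_const]

/-- In particular `W_k(⊗vᵢ) = Πᵢ qubitMoment k vᵢ`.
[cite: LeoneOlivieroHamma2021, property (iii) (additivity)] -/
theorem moment_productKet (k : ℕ) (v : Fin n → Bool → ℂ)
    (hv : ∀ i, ‖v i false‖ ^ 2 + ‖v i true‖ ^ 2 = 1) :
    moment k (productKet v) = ∏ i, qubitMoment k (v i) := by
  rw [← cutMoment_univ, cutMoment_productKet _ _ _ hv]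

/-! ### (4) The witness `u = (2|0⟩ + |1⟩)/√5` and the separation -/

/-- The real single-qubit state `u = (2|0⟩ + |1⟩)/√5`. [folklore] -/
def uKet : Bool → ℂ := fun b => if b then ((1 / Real.sqrt 5 : ℝ) : ℂ) else ((2 / Real.sqrt 5 : ℝ) : ℂ)

/-- `(√5)² = 5`. [folklore] -/
private theorem sqrt5_sq : Real.sqrt 5 ^ 2 = 5 := Real.sq_sqrt (by norm_num)

/-- `u₀ ū₀ = 4/5`. [folklore] -/
private theorem uKet_false_mul_conj : uKet false * starRingEnd ℂ (uKet false) = 4 / 5 := by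
  simp only [uKet, Bool.false_eq_true, if_false, Complex.conj_ofReal, ← Complex.ofReal_mul]
  rw [show (2 / Real.sqrt 5 : ℝ) * (2 / Real.sqrt 5) = 4 / Real.sqrt 5 ^ 2 by ring, sqrt5_sq]; push_cast; ring

/-- `u₁ ū₁ = 1/5`. [folklore] -/
private theorem uKet_true_mul_conj : uKet true * starRingEnd ℂ (uKet true) = 1 / 5 := by
  simp only [uKet, if_true, Complex.conj_ofReal, ← Complex.ofReal_mul]
  rw [show (1 / Real.sqrt 5 : ℝ) * (1 / Real.sqrt 5) = 1 / Real.sqrt 5 ^ 2 by ring, sqrt5_sq]; push_cast; ring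

/-- `u₀ ū₁ = 2/5`. [folklore] -/
private theorem uKet_false_mul_conj_true : uKet false * starRingEnd ℂ (uKet true) = 2 / 5 := by
  simp only [uKet, if_true, Bool.false_eq_true, if_false, Complex.conj_ofReal, ← Complex.ofReal_mul]
  rw [show (2 / Real.sqrt 5 : ℝ) * (1 / Real.sqrt 5) = 2 / Real.sqrt 5 ^ 2 by ring, sqrt5_sq]; push_cast; ring

/-- `u₁ ū₀ = 2/5`. [folklore] -/
private theorem uKet_true_mul_conj_false : uKet true * starRingEnd ℂ (uKet false) = 2 / 5 := by
  simp only [uKet, if_true, Bool.false_eq_true, if_false, Complex.conj_ofReal, ← Complex.ofReal_mul]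
  rw [show (1 / Real.sqrt 5 : ℝ) * (2 / Real.sqrt 5) = 2 / Real.sqrt 5 ^ 2 by ring, sqrt5_sq]; push_cast; ring

/-- The four Pauli expectations of `u`: `a_I = 1, a_X = 4/5, a_Y = 0, a_Z = 3/5`.
[cite: LeoneOlivieroHamma2021, eq. (1) (`Ξ_P(ψ) = d⁻¹⟨ψ|P|ψ⟩²`)] -/
theorem qubitExp_uKet : qubitExp uKet Pauli.I = 1 ∧ qubitExp uKet Pauli.X = 4 / 5 ∧
    qubitExp uKet Pauli.Y = 0 ∧ qubitExp uKet Pauli.Z = 3 / 5 := by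
  simp only [qubitExp, qubitProj, Pauli.mat, Matrix.trace, Matrix.diag_apply, Matrix.mul_apply,
    Matrix.of_apply, Matrix.one_apply, Fintype.sum_bool]
  simp only [if_true, Bool.false_eq_true, Bool.true_eq_false, if_false, one_mul, zero_mul, add_zero,
    zero_add, Complex.star_def, uKet_false_mul_conj, uKet_true_mul_conj, uKet_false_mul_conj_true,
    uKet_true_mul_conj_false]
  refine ⟨by norm_num, by norm_num, by ring, by norm_num⟩

/-- `|u₀|² = 4/5`. [folklore] -/
private theorem norm_uKet_false_sq : ‖uKet false‖ ^ 2 = 4 / 5 := by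
  simp only [uKet, Bool.false_eq_true, if_false, Complex.norm_real, Real.norm_eq_abs, sq_abs, div_pow,
    sqrt5_sq]; norm_num

/-- `|u₁|² = 1/5`. [folklore] -/
private theorem norm_uKet_true_sq : ‖uKet true‖ ^ 2 = 1 / 5 := by
  simp only [uKet, if_true, Complex.norm_real, Real.norm_eq_abs, sq_abs, div_pow, sqrt5_sq]; norm_num

/-- `u` is a unit vector. [cite: NielsenChuang2010, §1.2] -/
theorem uKet_unit : ‖uKet false‖ ^ 2 + ‖uKet true‖ ^ 2 = 1 := by
  rw [norm_uKet_false_sq, norm_uKet_true_sq]; norm_num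

/-- `qubitMoment 1 u = (1 + 16/25 + 0 + 9/25)/2 = 1` (pure: Parseval). [cite: KempeEtAl2010, Lemma 7] -/
theorem qubitMoment_one_uKet : qubitMoment 1 uKet = 1 := by
  obtain ⟨hI, hX, hY, hZ⟩ := qubitExp_uKet
  rw [qubitMoment, Pauli.sum_univ, hI, hX, hY, hZ]; norm_num

/-- `qubitMoment 2 u = (1 + 256/625 + 0 + 81/625)/2 = 481/625`.
[cite: LeoneOlivieroHamma2021, eq. (1)–(2)] -/
theorem qubitMoment_two_uKet : qubitMoment 2 uKet = 481 / 625 := by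
  obtain ⟨hI, hX, hY, hZ⟩ := qubitExp_uKet
  rw [qubitMoment, Pauli.sum_univ, hI, hX, hY, hZ]; norm_num

/-- The product family `u^{⊗n}`. [folklore] -/
def uProd (n : ℕ) : Reg n → ℂ := productKet fun _ : Fin n => uKet

/-- `u^{⊗n}` has EVERY cut purity equal to `1` (pure marginals: bond dimension `1` across every cut).
[cite: NielsenChuang2010, §2.5 (product state ⇔ Schmidt number 1, pure reduced states)] -/
theorem cutMoment_one_uProd (n : ℕ) (W : Finset (Fin n)) : cutMoment W 1 (uProd n) = 1 := by
  rw [uProd, cutMoment_productKet _ _ _ (fun _ => uKet_unit)]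
  simp [qubitMoment_one_uKet]

/-- … yet its stabilizer 4th moment is `W₂(u^{⊗n}) = (481/625)ⁿ`.
[cite: LeoneOlivieroHamma2021, property (iii) (additivity)] -/
theorem moment_two_uProd (n : ℕ) : moment 2 (uProd n) = (481 / 625) ^ n := by
  rw [uProd, moment_productKet _ _ (fun _ => uKet_unit)]
  simp [qubitMoment_two_uKet, div_pow]

/-- `u^{⊗n}` is a unit vector (through `a_I = ‖·‖²`). [cite: NielsenChuang2010, §2.1.7] -/
theorem normSq_uProd (n : ℕ) : normSq (uProd n) = 1 := by
  have h : pauliExp (uProd n) (idWord n) = 1 := by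
    rw [uProd, pauliExp_productKet]; simp [idWord, qubitExp_uKet.1]
  rw [pauliExp_idWord] at h
  exact_mod_cast h

/-- SEPARATION (a): on the bond-dimension-1 state `u^{⊗n}` every stabilizer-frame superposition
`φ = Σ cᵢ tᵢ` has `|⟨φ|u^{⊗n}⟩|⁸ ≤ ‖c‖₁⁸ · (481/625)ⁿ` ((T0) at `k = 2`), i.e. fidelity `F` needs extent
weight `‖c‖₁² ≥ F · (625/481)^{n/4}`. [cite: BravyiEtAl2019, §2] -/
theorem extentReach_uProd (n r : ℕ) (c : Fin r → ℂ) (t : Fin r → Reg n → ℂ) (F : ∀ i, StabFrame (t i)) :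
    ‖braket (fun x => ∑ i, c i * t i x) (uProd n)‖ ^ 8 ≤ (∑ i, ‖c i‖) ^ 8 * (481 / 625) ^ n := by
  have h := superposition_ceiling c t F (uProd n) 2
  rwa [moment_two_uProd] at h

/-- SEPARATION (b): every product state (unit factors) has fidelity at most `1/2` with `|Φ⁺⟩` — a framed
state of extent `1` with `W₂ = 1` (Cauchy–Schwarz on the two diagonal amplitudes).
[cite: NielsenChuang2010, §2.5] -/
theorem braket_product_bell_le (v : Fin 2 → Bool → ℂ) (hv : ∀ i, ‖v i false‖ ^ 2 + ‖v i true‖ ^ 2 = 1) :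
    ‖braket (productKet v) bellKet‖ ^ 2 ≤ 1 / 2 := by
  have hb : braket (productKet v) bellKet =
      bellAmp * (star (v 0 false * v 1 false) + star (v 0 true * v 1 true)) := by
    rw [braket, sum_reg_two]
    simp [bellKet, productKet, Fin.prod_univ_two, mul_add, mul_comm]
    ring
  rw [hb, norm_mul, mul_pow, norm_bellAmp_sq]
  have hcs : ‖star (v 0 false * v 1 false) + star (v 0 true * v 1 true)‖ ^ 2 ≤ 1 := by
    have h0 := hv 0; have h1 := hv 1
    calc ‖star (v 0 false * v 1 false) + star (v 0 true * v 1 true)‖ ^ 2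
        ≤ (‖star (v 0 false * v 1 false)‖ + ‖star (v 0 true * v 1 true)‖) ^ 2 := by
          gcongr; exact norm_add_le _ _
      _ = (‖v 0 false‖ * ‖v 1 false‖ + ‖v 0 true‖ * ‖v 1 true‖) ^ 2 := by simp
      _ ≤ (‖v 0 false‖ ^ 2 + ‖v 0 true‖ ^ 2) * (‖v 1 false‖ ^ 2 + ‖v 1 true‖ ^ 2) := by
          nlinarith [sq_nonneg (‖v 0 false‖ * ‖v 1 true‖ - ‖v 0 true‖ * ‖v 1 false‖),
            norm_nonneg (v 0 false), norm_nonneg (v 1 false), norm_nonneg (v 0 true), norm_nonneg (v 1 true)]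
      _ = 1 := by rw [h0, h1, mul_one]
  linarith

end Literature.Computability.QuantumComplexity.PauliMoments

end
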